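import Summits.AtomisticToContinuum.BoseEinsteinCondensation.Theses.BECSyncSkeleton

/-!
# `Assembly` (item stmt-AtomisticToContinuum-12374 of route BECSyncSkeleton)

`Assembly := InhomogeneousRotorLRO → SkeletonDomination → SkeletonCounting → BoundaryTransferWeak →
BoseEinsteinCondensation` — identical to the type of the route's deciding theorem `closes`.

Pure logic: for an admissible `v`, `SkeletonCounting InhomogeneousRotorLRO SkeletonDomination v hv`
is the periodic-BEC hypothesis of `BoundaryTransferWeak v hv`, whose conclusion
`∃ ρ₀ > 0, ∀ ρ ∈ (0, ρ₀), HasGroundStateBEC v ρ` is the `v`-instance of the sub-problem Statement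
`BoseEinsteinCondensation` (an `abbrev` for
`Literature.MathematicalPhysics.QuantumManyBody.BoseGas.BoseEinsteinCondensation`). No analysis is
involved; this file only records the composition so that the gate can close the item against the
exact route decl. (The support `SkeletonCounting` itself is the in-tree theorem
`skeletonCounting_proof`, `Theorems/BECSyncSkeletonSkeletonCounting.lean`; it is not needed here
since `Assembly` takes it as a hypothesis.)
-/

namespace Summit.AtomisticToContinuum.BoseEinsteinCondensation.Theorems

open Summit.AtomisticToContinuum.BoseEinsteinCondensation.Theses.BECSyncSkeleton

/-- **`Assembly` holds** (settles stmt-AtomisticToContinuum-12374, exact route decl of route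
BECSyncSkeleton): given `h₂ : InhomogeneousRotorLRO`, `h₃ : SkeletonDomination`,
`h₉ : SkeletonCounting` and `h₄ : BoundaryTransferWeak`, for every repulsive finite-range `v` the
periodic condensation statement `h₉ h₂ h₃ v hv` feeds `h₄ v hv`, whose conclusion is the
`v`-instance of `BoseEinsteinCondensation`. Pure composition (the body of `closes`). [folklore] -/
theorem becSyncSkeleton_assembly_proof :
    Summit.AtomisticToContinuum.BoseEinsteinCondensation.Theses.BECSyncSkeleton.Assembly := by
  unfold Summit.AtomisticToContinuum.BoseEinsteinCondensation.Theses.BECSyncSkeleton.Assembly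
  intro h₂ h₃ h₉ h₄ v hv
  exact h₄ v hv (h₉ h₂ h₃ v hv)

end Summit.AtomisticToContinuum.BoseEinsteinCondensation.Theorems
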